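import Literature.Analysis.FluidPDE.PassiveScalarEnergyDecay
import Literature.Analysis.FluidPDE.EulerDecayUniqueness
import HarnessLib

/-!
# Crux `SelfMixingDichotomy.CoherentScaleExclusion` (stmt-NavierStokesRegularity-1423), line
  `registered`: tools for STUB STAB `stub_mixClass_driftStability` — the fixed-time energy
  production of the difference of two passive scalars (whole space)

Support file (`--supports stmt-NavierStokesRegularity-1423`, tools file 1/2) for the registered
sub-goal `stub_mixClass_driftStability` of the lead's skeleton
`Cruxes/CoherentScaleExclusion/Lines/birth.lean` (lead c3, wave 2: robustness of the MIX functional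
under perturbation of the drift). The stub itself — the whole-space, MIX-class analogue of
Johansson–Sorella 2024, Lemma 2.2 (stability of passive scalars in the drift; ON THE TORUS in
`Literature/Analysis/FluidPDE/PassiveScalarDriftStability`) — is assembled in the companion file
`…MixDriftStability.lean` from the fixed-time inequality proved here.

Fixed time, no time variable (energy method for `w = θ₁ − θ₂`, identity (2.1) of the source
integrated over the whole space):
* `mixDriftStability_integrable_mul_inner`: a transport pairing `f ⟪v, g⟫` with `f`, `g` decaying
  like `(1 + ‖x‖)^{-r}`, `dim E < r`, and `v ∈ L²` is integrable
  (`|f| ‖g‖ ‖v‖ ≤ (C₁C₂)² (1 + ‖x‖)^{-r} + ‖v‖²`).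
* `mixDriftStability_production_le_core`: if `d = Δw − ⟪u₁, ∇w⟫ − ⟪v, ∇θ₂⟫` pointwise with `w`,
  `θ₂` decaying and `u₁`, `v` `C¹`, divergence free, `L²`, `|θ₂| ≤ M`, then `∫ 2 w d ≤ M² ∫ ‖v‖²`:
  `∫ w Δw = −∫ ‖Dw‖²` (`integral_mul_laplacian_self_eq_neg_integral_norm_fderiv_sq`),
  `∫ w ⟪u₁, ∇w⟫ = 0` (`integral_mul_inner_gradient_eq_zero_of_memLp`), the cross term is moved onto
  `w` by polarising the transport identity for the drift `v` (`T(w + θ₂) = T(w) = T(θ₂) = 0` gives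
  `∫ w ⟪v, ∇θ₂⟫ = −∫ θ₂ ⟪v, ∇w⟫`), and Young `2 θ₂ ⟪v, ∇w⟫ ≤ ‖Dw‖² + M² ‖v‖²` pointwise.
* `mixDriftStability_production_le`: the same for two scalars `θ₁`, `θ₂` with their equations
  `dᵢ + ⟪uᵢ, ∇θᵢ⟫ = Δθᵢ` (`w = θ₁ − θ₂`, `v = u₁ − u₂`; `∇`, `Δ`, `div` of a difference):
  `∫ 2 (θ₁ − θ₂)(d₁ − d₂) ≤ M² ∫ ‖u₁ − u₂‖²`.

References: C. J. P. Johansson, M. Sorella, arXiv:2409.03599 (2024), Lemma 2.2 and (2.1);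
A. J. Majda, A. L. Bertozzi, *Vorticity and Incompressible Flow* (CUP 2002), §3.1.1.
-/

noncomputable section

open MeasureTheory Set Function Filter Topology InnerProductSpace
open scoped ContDiff Laplacian InnerProductSpace RealInnerProductSpace

-- `Summit = Problem` for this summit; the tree lakefile sets `weak.linter.dupNamespace = false`.
set_option linter.dupNamespace false

namespace Summit.NavierStokesRegularity.NavierStokesRegularity.Theorems

open Literature.Analysis.FluidPDE

section General

variable {E : Type*} [NormedAddCommGroup E] [InnerProductSpace ℝ E] [FiniteDimensional ℝ E]
  [MeasurableSpace E] [BorelSpace E]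

omit [MeasurableSpace E] [BorelSpace E] in
/-- The Laplacian of a `C²` scalar field is continuous (`Δ = ∑ᵢ ∂ᵢ∂ᵢ` in an orthonormal frame). -/
theorem mixDriftStability_continuous_laplacian {f : E → ℝ} (hf : ContDiff ℝ 2 f) :
    Continuous (Δ f) := by
  set b := stdOrthonormalBasis ℝ E
  have hD2c : Continuous (fderiv ℝ (fderiv ℝ f)) :=
    (hf.fderiv_right (m := 1) (by norm_num)).continuous_fderiv one_ne_zero
  have heq : (Δ f) = fun x => ∑ i, fderiv ℝ (fderiv ℝ f) x (b i) (b i) :=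
    funext fun x => laplacian_apply_eq_sum_fderiv_fderiv b f x
  rw [heq]
  exact continuous_finsetSum _ fun i _ =>
    (hD2c.clm_apply continuous_const).clm_apply continuous_const

/-- **Integrability of a transport pairing `f ⟪v, g⟫`** for continuous `f`, `g` decaying like
`(1 + ‖x‖)^{-r}`, `dim E < r`, and `v ∈ L²(E)`: `|f| ‖g‖ ‖v‖ ≤ (C₁C₂)² (1 + ‖x‖)^{-r} + ‖v‖²`. -/
theorem mixDriftStability_integrable_mul_inner {f : E → ℝ} {g v : E → E}
    (hf : Continuous f) (hg : Continuous g) (hv : MemLp v 2 (volume : Measure E))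
    {C₁ C₂ r : ℝ} (hC₁ : 0 ≤ C₁) (hC₂ : 0 ≤ C₂) (hr : (Module.finrank ℝ E : ℝ) < r)
    (h0 : ∀ x, ‖f x‖ ≤ C₁ * (1 + ‖x‖) ^ (-r)) (h1 : ∀ x, ‖g x‖ ≤ C₂ * (1 + ‖x‖) ^ (-r)) :
    Integrable (fun x => f x * ⟪v x, g x⟫) (volume : Measure E) := by
  have hr0 : 0 ≤ r := (Nat.cast_nonneg _).trans hr.le
  have hv2 : Integrable (fun x => ‖v x‖ ^ 2) (volume : Measure E) :=
    (memLp_two_iff_integrable_sq_norm hv.1).1 hv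
  set bound : E → ℝ := fun x => (C₁ * C₂) ^ 2 * (1 + ‖x‖) ^ (-r) + ‖v x‖ ^ 2 with hbound_def
  have hbound : Integrable bound (volume : Measure E) :=
    ((integrable_one_add_norm hr).const_mul ((C₁ * C₂) ^ 2)).add hv2
  refine Integrable.mono' hbound
    (hf.aestronglyMeasurable.mul (hv.1.inner hg.aestronglyMeasurable))
    (Eventually.of_forall fun x => ?_)
  set w : ℝ := (1 + ‖x‖) ^ (-r) with hw_def
  have hw0 : 0 ≤ w := Real.rpow_nonneg (by positivity) _
  have hw1 : w ≤ 1 := rpow_neg_le_one x hr0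
  have hfg : ‖f x‖ * ‖g x‖ ≤ C₁ * C₂ * w := by
    calc ‖f x‖ * ‖g x‖ ≤ C₁ * w * (C₂ * w) :=
          mul_le_mul (h0 x) (h1 x) (norm_nonneg _) (by positivity)
      _ ≤ C₁ * w * (C₂ * 1) := by gcongr
      _ = C₁ * C₂ * w := by ring
  rw [norm_mul, hbound_def]
  calc ‖f x‖ * ‖⟪v x, g x⟫‖ ≤ ‖f x‖ * (‖v x‖ * ‖g x‖) := by
        gcongr; exact norm_inner_le_norm _ _
    _ = ‖f x‖ * ‖g x‖ * ‖v x‖ := by ring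
    _ ≤ C₁ * C₂ * w * ‖v x‖ := by gcongr
    _ ≤ (C₁ * C₂ * w) ^ 2 + ‖v x‖ ^ 2 := by
        nlinarith [sq_nonneg (C₁ * C₂ * w - ‖v x‖), sq_nonneg (C₁ * C₂ * w), sq_nonneg ‖v x‖]
    _ ≤ (C₁ * C₂) ^ 2 * w + ‖v x‖ ^ 2 := by
        gcongr ?_ + _
        calc (C₁ * C₂ * w) ^ 2 = (C₁ * C₂) ^ 2 * (w * w) := by ring
          _ ≤ (C₁ * C₂) ^ 2 * (w * 1) := by gcongr
          _ = (C₁ * C₂) ^ 2 * w := by ring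

/-- **The energy production of the difference, core form (fixed time).** Let `w`, `θ₂ : E → ℝ`
(`w` of class `C²`, `θ₂` of class `C¹`) decay with their derivatives like `(1 + ‖x‖)^{-r}`,
`dim E < r`, let `u₁`, `v` be `C¹`, divergence free and square integrable, `|θ₂| ≤ M`, and let
`d = Δw − ⟪u₁, ∇w⟫ − ⟪v, ∇θ₂⟫` pointwise. Then `∫ 2 w d ≤ M² ∫ ‖v‖²`:
`∫ w Δw = −∫ ‖Dw‖²`, `∫ w ⟪u₁, ∇w⟫ = 0`, `∫ w ⟪v, ∇θ₂⟫ = −∫ θ₂ ⟪v, ∇w⟫` (polarisation of the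
transport identity for `v` on `w + θ₂`, `w`, `θ₂`), and `2 θ₂ ⟪v, ∇w⟫ ≤ ‖Dw‖² + M² ‖v‖²`. -/
theorem mixDriftStability_production_le_core {w θ₂ d : E → ℝ} {u₁ v : E → E}
    (hw : ContDiff ℝ 2 w) (hθ₂ : ContDiff ℝ 1 θ₂)
    (hd : ∀ x, d x = (Δ w) x - ⟪u₁ x, gradient w x⟫ - ⟪v x, gradient θ₂ x⟫)
    (hu₁ : ContDiff ℝ 1 u₁) (hdiv₁ : VectorCalculus.IsDivFree u₁)
    (hL₁ : MemLp u₁ 2 (volume : Measure E))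
    (hv : ContDiff ℝ 1 v) (hdivv : VectorCalculus.IsDivFree v)
    (hLv : MemLp v 2 (volume : Measure E))
    {C r M : ℝ} (hC : 0 ≤ C) (hr : (Module.finrank ℝ E : ℝ) < r)
    (hw0 : ∀ x, ‖w x‖ ≤ C * (1 + ‖x‖) ^ (-r)) (hw1 : ∀ x, ‖fderiv ℝ w x‖ ≤ C * (1 + ‖x‖) ^ (-r))
    (hw2 : ∀ x, ‖fderiv ℝ (fderiv ℝ w) x‖ ≤ C * (1 + ‖x‖) ^ (-r))
    (h₂0 : ∀ x, ‖θ₂ x‖ ≤ C * (1 + ‖x‖) ^ (-r)) (h₂1 : ∀ x, ‖fderiv ℝ θ₂ x‖ ≤ C * (1 + ‖x‖) ^ (-r))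
    (hM : ∀ x, |θ₂ x| ≤ M) :
    ∫ x, 2 * (w x * d x) ≤ M ^ 2 * ∫ x, ‖v x‖ ^ 2 := by
  have hr0 : 0 ≤ r := (Nat.cast_nonneg _).trans hr.le
  have h2C : 0 ≤ 2 * C := by positivity
  have hw1c : ContDiff ℝ 1 w := hw.of_le one_le_two
  have hwd : Differentiable ℝ w := hw.differentiable two_ne_zero
  have hθ₂d : Differentiable ℝ θ₂ := hθ₂.differentiable one_ne_zero
  have hwc : Continuous w := hw.continuous
  have hθ₂c : Continuous θ₂ := hθ₂.continuous
  have hgwc : Continuous (gradient w) := continuous_gradient_of_contDiff hw1c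
  have hgθ₂c : Continuous (gradient θ₂) := continuous_gradient_of_contDiff hθ₂
  have hgw : ∀ x, ‖gradient w x‖ ≤ C * (1 + ‖x‖) ^ (-r) := fun x => by
    rw [norm_gradient_eq_norm_fderiv_real]; exact hw1 x
  have hgθ₂ : ∀ x, ‖gradient θ₂ x‖ ≤ C * (1 + ‖x‖) ^ (-r) := fun x => by
    rw [norm_gradient_eq_norm_fderiv_real]; exact h₂1 x
  -- the sum `w + θ₂` (the first scalar) and its decay
  have hs1 : ContDiff ℝ 1 (fun x => w x + θ₂ x) := hw1c.add hθ₂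
  have hs0 : ∀ x, ‖w x + θ₂ x‖ ≤ 2 * C * (1 + ‖x‖) ^ (-r) := fun x => by
    refine (norm_add_le _ _).trans ?_
    have := hw0 x; have := h₂0 x; linarith
  have hsd : ∀ x, ‖fderiv ℝ (fun y => w y + θ₂ y) x‖ ≤ 2 * C * (1 + ‖x‖) ^ (-r) := fun x => by
    rw [fderiv_fun_add (hwd x) (hθ₂d x)]
    refine (norm_add_le _ _).trans ?_
    have := hw1 x; have := h₂1 x; linarith
  have hgs : ∀ x, gradient (fun y => w y + θ₂ y) x = gradient w x + gradient θ₂ x := fun x => by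
    simp only [gradient, fderiv_fun_add (hwd x) (hθ₂d x), map_add]
  -- integrability of the pairings
  have iΔ : Integrable (fun x => w x * (Δ w) x) (volume : Measure E) := by
    refine integrable_of_norm_le_decay_mul_decay (C₁ := C) (C₂ := Module.finrank ℝ E * C)
      (r := r) (r' := r) (hwc.mul (mixDriftStability_continuous_laplacian hw)) hr hr0 hC
      (by positivity) fun x => ?_
    rw [norm_mul]
    refine mul_le_mul (hw0 x) ((norm_laplacian_le w x).trans ?_) (norm_nonneg _) (by positivity)
    rw [mul_assoc]
    gcongr
    exact hw2 x
  have iT : Integrable (fun x => w x * ⟪u₁ x, gradient w x⟫) (volume : Measure E) :=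
    mixDriftStability_integrable_mul_inner hwc hgwc hL₁ hC hC hr hw0 hgw
  have iX : Integrable (fun x => w x * ⟪v x, gradient θ₂ x⟫) (volume : Measure E) :=
    mixDriftStability_integrable_mul_inner hwc hgθ₂c hLv hC hC hr hw0 hgθ₂
  have iY : Integrable (fun x => θ₂ x * ⟪v x, gradient w x⟫) (volume : Measure E) :=
    mixDriftStability_integrable_mul_inner hθ₂c hgwc hLv hC hC hr h₂0 hgw
  have iW : Integrable (fun x => w x * ⟪v x, gradient w x⟫) (volume : Measure E) :=
    mixDriftStability_integrable_mul_inner hwc hgwc hLv hC hC hr hw0 hgw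
  have i2 : Integrable (fun x => θ₂ x * ⟪v x, gradient θ₂ x⟫) (volume : Measure E) :=
    mixDriftStability_integrable_mul_inner hθ₂c hgθ₂c hLv hC hC hr h₂0 hgθ₂
  -- Green's identity and the transport identities
  have hG : ∫ x, w x * (Δ w) x = -∫ x, ‖fderiv ℝ w x‖ ^ 2 :=
    integral_mul_laplacian_self_eq_neg_integral_norm_fderiv_sq hw hC hr hw0 hw1 hw2
  have hT : ∫ x, w x * ⟪u₁ x, gradient w x⟫ = 0 :=
    integral_mul_inner_gradient_eq_zero_of_memLp hu₁ hdiv₁ hL₁ hw1c hC hr hw0 hw1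
  have hTs : ∫ x, (w x + θ₂ x) * ⟪v x, gradient (fun y => w y + θ₂ y) x⟫ = 0 :=
    integral_mul_inner_gradient_eq_zero_of_memLp hv hdivv hLv hs1 h2C hr hs0 hsd
  have hTw : ∫ x, w x * ⟪v x, gradient w x⟫ = 0 :=
    integral_mul_inner_gradient_eq_zero_of_memLp hv hdivv hLv hw1c hC hr hw0 hw1
  have hT2 : ∫ x, θ₂ x * ⟪v x, gradient θ₂ x⟫ = 0 :=
    integral_mul_inner_gradient_eq_zero_of_memLp hv hdivv hLv hθ₂ hC hr h₂0 h₂1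
  -- polarisation: `∫ w ⟪v, ∇θ₂⟫ = -∫ θ₂ ⟪v, ∇w⟫`
  have hpol : ∫ x, w x * ⟪v x, gradient θ₂ x⟫ = -∫ x, θ₂ x * ⟪v x, gradient w x⟫ := by
    have iWX : Integrable (fun x => w x * ⟪v x, gradient w x⟫ + w x * ⟪v x, gradient θ₂ x⟫)
        (volume : Measure E) := iW.add iX
    have iWXY : Integrable (fun x => w x * ⟪v x, gradient w x⟫ + w x * ⟪v x, gradient θ₂ x⟫ +
        θ₂ x * ⟪v x, gradient w x⟫) (volume : Measure E) := iWX.add iY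
    have hsplit : ∫ x, (w x + θ₂ x) * ⟪v x, gradient (fun y => w y + θ₂ y) x⟫ =
        ∫ x, (w x * ⟪v x, gradient w x⟫ + w x * ⟪v x, gradient θ₂ x⟫ +
          θ₂ x * ⟪v x, gradient w x⟫ + θ₂ x * ⟪v x, gradient θ₂ x⟫) := by
      refine integral_congr_ae (Eventually.of_forall fun x => ?_)
      simp only [hgs x, inner_add_right]
      ring
    rw [integral_add iWXY i2, integral_add iWX iY, integral_add iW iX, hTw, hT2, hTs] at hsplit
    linarith
  -- Young: `2 ∫ θ₂ ⟪v, ∇w⟫ ≤ ∫ ‖Dw‖² + M² ∫ ‖v‖²`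
  have hv2 : Integrable (fun x => ‖v x‖ ^ 2) (volume : Measure E) :=
    (memLp_two_iff_integrable_sq_norm hLv.1).1 hLv
  have hG2 : Integrable (fun x => ‖fderiv ℝ w x‖ ^ 2) (volume : Measure E) := by
    refine integrable_of_norm_le_decay_mul_decay (C₁ := C) (C₂ := C) (r := r) (r' := r)
      ((hw.continuous_fderiv two_ne_zero).norm.pow 2) hr hr0 hC hC fun x => ?_
    rw [norm_pow, norm_norm, sq]
    exact mul_le_mul (hw1 x) (hw1 x) (norm_nonneg _) (by positivity)
  have hY : 2 * ∫ x, θ₂ x * ⟪v x, gradient w x⟫ ≤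
      (∫ x, ‖fderiv ℝ w x‖ ^ 2) + M ^ 2 * ∫ x, ‖v x‖ ^ 2 := by
    have i6 : Integrable (fun x => ‖fderiv ℝ w x‖ ^ 2 + M ^ 2 * ‖v x‖ ^ 2)
        (volume : Measure E) := hG2.add (hv2.const_mul _)
    have hpt : ∀ x, 2 * (θ₂ x * ⟪v x, gradient w x⟫) ≤
        ‖fderiv ℝ w x‖ ^ 2 + M ^ 2 * ‖v x‖ ^ 2 := by
      intro x
      have hM0 : 0 ≤ M := (abs_nonneg _).trans (hM x)
      have hin : |⟪v x, gradient w x⟫| ≤ ‖v x‖ * ‖fderiv ℝ w x‖ := by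
        rw [← norm_gradient_eq_norm_fderiv_real]; exact abs_real_inner_le_norm _ _
      have hprod : |θ₂ x * ⟪v x, gradient w x⟫| ≤ M * (‖v x‖ * ‖fderiv ℝ w x‖) := by
        rw [abs_mul]; exact mul_le_mul (hM x) hin (abs_nonneg _) hM0
      have hle := le_abs_self (θ₂ x * ⟪v x, gradient w x⟫)
      nlinarith [sq_nonneg (‖fderiv ℝ w x‖ - M * ‖v x‖)]
    calc 2 * ∫ x, θ₂ x * ⟪v x, gradient w x⟫ = ∫ x, 2 * (θ₂ x * ⟪v x, gradient w x⟫) :=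
          (integral_const_mul _ _).symm
      _ ≤ ∫ x, (‖fderiv ℝ w x‖ ^ 2 + M ^ 2 * ‖v x‖ ^ 2) :=
          integral_mono (iY.const_mul _) i6 hpt
      _ = (∫ x, ‖fderiv ℝ w x‖ ^ 2) + M ^ 2 * ∫ x, ‖v x‖ ^ 2 := by
          rw [integral_add hG2 (hv2.const_mul _), integral_const_mul]
  -- assemble
  have hww : ∀ x, 2 * (w x * d x) = 2 * (w x * (Δ w) x) - 2 * (w x * ⟪u₁ x, gradient w x⟫) -
      2 * (w x * ⟪v x, gradient θ₂ x⟫) := fun x => by rw [hd x]; ring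
  have j1 : Integrable (fun x => 2 * (w x * (Δ w) x)) (volume : Measure E) := iΔ.const_mul _
  have j2 : Integrable (fun x => 2 * (w x * ⟪u₁ x, gradient w x⟫)) (volume : Measure E) :=
    iT.const_mul _
  have j3 : Integrable (fun x => 2 * (w x * ⟪v x, gradient θ₂ x⟫)) (volume : Measure E) :=
    iX.const_mul _
  have j12 : Integrable (fun x => 2 * (w x * (Δ w) x) - 2 * (w x * ⟪u₁ x, gradient w x⟫))
      (volume : Measure E) := j1.sub j2
  have hGnn : 0 ≤ ∫ x, ‖fderiv ℝ w x‖ ^ 2 := integral_nonneg fun x => sq_nonneg _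
  simp_rw [hww]
  rw [integral_sub j12 j3, integral_sub j1 j2, integral_const_mul, integral_const_mul,
    integral_const_mul, hG, hT, hpol]
  linarith

/-- **The energy production of the difference of two passive scalars (fixed time).** For `C²`
scalars `θ₁`, `θ₂` decaying with two derivatives like `(1 + ‖x‖)^{-r}`, `dim E < r`, satisfying
`dᵢ + ⟪uᵢ, ∇θᵢ⟫ = Δθᵢ` pointwise with `C¹`, divergence-free, square-integrable drifts `u₁`, `u₂`,
and `|θ₂| ≤ M`: `∫ 2 (θ₁ − θ₂)(d₁ − d₂) ≤ M² ∫ ‖u₁ − u₂‖²` (Johansson–Sorella 2024, identity (2.1)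
integrated; `mixDriftStability_production_le_core` with `w = θ₁ − θ₂`, `v = u₁ − u₂`). -/
theorem mixDriftStability_production_le {θ₁ θ₂ d₁ d₂ : E → ℝ} {u₁ u₂ : E → E}
    (hθ₁ : ContDiff ℝ 2 θ₁) (hθ₂ : ContDiff ℝ 2 θ₂)
    (he₁ : ∀ x, d₁ x + ⟪u₁ x, gradient θ₁ x⟫ = (Δ θ₁) x)
    (he₂ : ∀ x, d₂ x + ⟪u₂ x, gradient θ₂ x⟫ = (Δ θ₂) x)
    (hu₁ : ContDiff ℝ 1 u₁) (hdiv₁ : VectorCalculus.IsDivFree u₁)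
    (hL₁ : MemLp u₁ 2 (volume : Measure E))
    (hu₂ : ContDiff ℝ 1 u₂) (hdiv₂ : VectorCalculus.IsDivFree u₂)
    (hL₂ : MemLp u₂ 2 (volume : Measure E))
    {C r M : ℝ} (hC : 0 ≤ C) (hr : (Module.finrank ℝ E : ℝ) < r)
    (h₁0 : ∀ x, ‖θ₁ x‖ ≤ C * (1 + ‖x‖) ^ (-r)) (h₁1 : ∀ x, ‖fderiv ℝ θ₁ x‖ ≤ C * (1 + ‖x‖) ^ (-r))
    (h₁2 : ∀ x, ‖fderiv ℝ (fderiv ℝ θ₁) x‖ ≤ C * (1 + ‖x‖) ^ (-r))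
    (h₂0 : ∀ x, ‖θ₂ x‖ ≤ C * (1 + ‖x‖) ^ (-r)) (h₂1 : ∀ x, ‖fderiv ℝ θ₂ x‖ ≤ C * (1 + ‖x‖) ^ (-r))
    (h₂2 : ∀ x, ‖fderiv ℝ (fderiv ℝ θ₂) x‖ ≤ C * (1 + ‖x‖) ^ (-r))
    (hM : ∀ x, |θ₂ x| ≤ M) :
    ∫ x, 2 * ((θ₁ x - θ₂ x) * (d₁ x - d₂ x)) ≤ M ^ 2 * ∫ x, ‖u₁ x - u₂ x‖ ^ 2 := by
  have h2C : 0 ≤ 2 * C := by positivity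
  have hd₁ : Differentiable ℝ θ₁ := hθ₁.differentiable two_ne_zero
  have hd₂ : Differentiable ℝ θ₂ := hθ₂.differentiable two_ne_zero
  have hD₁ : Differentiable ℝ (fderiv ℝ θ₁) :=
    (hθ₁.fderiv_right (m := 1) (by norm_num)).differentiable one_ne_zero
  have hD₂ : Differentiable ℝ (fderiv ℝ θ₂) :=
    (hθ₂.fderiv_right (m := 1) (by norm_num)).differentiable one_ne_zero
  have hfw : fderiv ℝ (fun y => θ₁ y - θ₂ y) = fun y => fderiv ℝ θ₁ y - fderiv ℝ θ₂ y :=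
    funext fun y => fderiv_fun_sub (hd₁ y) (hd₂ y)
  refine mixDriftStability_production_le_core (w := fun x => θ₁ x - θ₂ x) (θ₂ := θ₂)
    (d := fun x => d₁ x - d₂ x) (u₁ := u₁) (v := fun x => u₁ x - u₂ x)
    (hθ₁.sub hθ₂) (hθ₂.of_le one_le_two) (fun x => ?_) hu₁ hdiv₁ hL₁ (hu₁.sub hu₂) (fun x => ?_)
    (hL₁.sub hL₂) h2C hr (fun x => ?_) (fun x => ?_) (fun x => ?_)
    (fun x => le_decay_of_le_decay x (h₂0 x) (by linarith))
    (fun x => le_decay_of_le_decay x (h₂1 x) (by linarith)) hM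
  · -- the equation for `w = θ₁ - θ₂`
    have hg : gradient (fun y => θ₁ y - θ₂ y) x = gradient θ₁ x - gradient θ₂ x :=
      gradient_sub_apply hd₁ hd₂ x
    have hΔ : (Δ (fun y => θ₁ y - θ₂ y)) x = (Δ θ₁) x - (Δ θ₂) x :=
      laplacian_sub_apply_of_contDiff hθ₁ hθ₂ x
    rw [hg, hΔ, inner_sub_right, inner_sub_left]
    have e₁ := he₁ x
    have e₂ := he₂ x
    linarith
  · -- `div (u₁ - u₂) = 0`
    have e : VectorCalculus.divergence (fun y => u₁ y - u₂ y) x =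
        VectorCalculus.divergence u₁ x - VectorCalculus.divergence u₂ x := by
      simp only [VectorCalculus.divergence, fderiv_fun_sub (hu₁.differentiable one_ne_zero x)
        (hu₂.differentiable one_ne_zero x), ContinuousLinearMap.toLinearMap_sub, map_sub]
    rw [e, hdiv₁ x, hdiv₂ x, sub_zero]
  · refine (norm_sub_le _ _).trans ?_
    have := h₁0 x; have := h₂0 x; linarith
  · rw [hfw]
    refine (norm_sub_le _ _).trans ?_
    have := h₁1 x; have := h₂1 x; linarith
  · rw [hfw, fderiv_fun_sub (hD₁ x) (hD₂ x)]
    refine (norm_sub_le (fderiv ℝ (fderiv ℝ θ₁) x) (fderiv ℝ (fderiv ℝ θ₂) x)).trans ?_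
    have := h₁2 x; have := h₂2 x; linarith

end General

end Summit.NavierStokesRegularity.NavierStokesRegularity.Theorems

end
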